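import Summits.HodgeConjecture.HodgeConjecture.Theses.HeckePrymWeil
import Summits.HodgeConjecture.HodgeConjecture.Theorems.WeilTwelvefoldsSqrtMinus7.Negative.EigenvalueTyping
import Literature.AlgebraicGeometry.Motives.AbelianVarietyProduct
import Literature.AlgebraicGeometry.Motives.AbelianVarietyProductDimProofs
import Literature.AlgebraicGeometry.Motives.HyperbolicWeilType
import Literature.AlgebraicGeometry.Motives.WeilDiscriminantRealization
import Literature.AlgebraicGeometry.HodgeTheory.WeilClassesFourfoldsProofs
import Literature.NumberTheory.QuadraticForms.Meyer
import HarnessLib.Audit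

/-!
# Line `amnesic-secant-sheaves-split-fourteenfolds` — skeleton for crux
# `HeckePrymWeil.WeilTwelvefoldsSqrtMinus7` (item stmt-HodgeConjecture-1261)

Route `route-HodgeConjecture-HeckePrymWeil`; crux-plan by
`planner-cruxplan-stmt-HodgeConjecture-1261-amnesic-secant-sheav-0`, 2026-08-16; idea card
`Cruxes/WeilTwelvefoldsSqrtMinus7/Ideas/amnesic-secant-sheaves-split-fourteenfolds.md` (triage r1:
pass ×3, "could not break; doubt on existence of the amnesic object").

Crux (FIXED, the route's typing): on every complex abelian 12-fold `A` with `φ ≫ φ = -7` every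
rational `(6,6)`-class of the Weil span `Eig((𝟙+φ)^*, (1+i√7)¹²) ⊔ Eig((𝟙+φ)^*, (1-i√7)¹²) ⊆ H¹²(A(ℂ);ℂ)`
is algebraic — ALL discriminants `det H ∈ ℚ^×/Nm(K^×)`, `K = ℚ(√-7)`; nothing is known in any
dimension `≥ 8` for any `K` (Markman2025SecantWeil §1.2; arXiv:2509.23403 §12).

## The line (card + triage M1: "one skeleton = aimed descent + existence + engine")

(D) AIMED DESCENT `14 → 12` (the card's first lemma `HypSplitFourteenSuffices`, triage-checked:
`disc(E×E, (ι,-ι), aΘ+bΘ) ≡ -ab`, so `ab ≡ disc A` puts `A × E × E` in discriminant `(-1)⁷ = -1`, the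
HYPERBOLIC component of `ℚ(√-7)`-Weil 14-folds, and Koike/Schoen projection descends). Typed here on
the real carriers exactly as the sibling crux's line `Cruxes/WeilSixfoldsSqrtMinus7/Lines/hyperbolic-eightfold-descent.lean`
one Witt step up: `stub_aimingArithmetic` (the lever `δ² = 1`, dimension-free — the SAME statement as
the sibling's stub 2: prove once, serves 1260 and 1261), `stub_hyperbolicPartner` (dim 12: the CM Weil
surface `B = E × E`, `E = ℂ/ℤ[(1+√-7)/2]`, descent pair, hyperbolic compatible class on `A × B`),
`stub_hodgeTypeExterior` (Künneth for Hodge types — the SAME statement as the sibling's stub 4),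
`stub_descent` (Schoen's projection `14 → 12` for one partner surface).

(C⁺) `stub_hyperbolicFourteenfolds` — the TRANSFER target, HARDEST and load-bearing: Hodge–Weil
classes are algebraic on every HYPERBOLIC polarised `ℚ(√-7)`-Weil 14-fold (Markman's Thm 1.5.1 one
secant object away: his machine — rational `K`-secant planes `P_τ ⊂ S⁺_K` in ALL `n` (§1.2), the
`Spin(V)_P`-invariance of `κ(ℰ) = ch(ℰ)·exp(-c₁/r)` (Cor. 1.3.2, all `n`), Orlov's
`Φ : D^b(X×X) ≃ D^b(X×X̂)`, `Ḡ`-equivariant descent to `Y = (X×X̂)/Ḡ` and the `μ_r`-twist (§1.5),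
his proof of the twisted Buchweitz–Flenner theorem for families of ABELIAN varieties (§9), and CDK/Baire
spreading over the irreducible component (proof of Thm 1.5.1, p. 74) — is dimension-free except for the
SUPPLY of a semiregular `K`-secant object on an abelian `n`-fold, which for `n = 3` comes from
Abel–Jacobi curves of genus 3 and is "special to genus 3" (p. 7). The card's diagnosis (F1): for `C`
non-hyperelliptic of genus `g`, `H¹(N_{C/J}) = ∧²H⁰(K_C)^∨ ⊕ I₂(C)^∨` and Bloch's `π_C` kills exactly
`I₂(C)^∨`, so AJ curves are semiregular iff `g ≤ 3` (Matsusaka–Ran in disguise); every Brill–Noether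
ingredient remembers the Jacobian locus. The bet: an AMNESIC object — a `G`-equivariant simple
theta-monad `0 → ⊕𝒪(m₁Θ)^{a₁} → ⋯ → ⊕𝒪(m₈Θ)^{a₈} → 0` on a ppav 7-fold with `ch ∈ P_α`,
`α = (1+√-7)/2` (moments `(2,1,-3,-5,1,11,9,-13)`), first-order unobstructed along ALL `28` polarised
and `21` gerby/Poisson directions (triage razor R; Markman p. 6 Cor.), with `dim Ext²(F,F)^G = 42 =
n(n-1)` and `κ₂ = a·h²`, `a ≠ 0` (triage cross-cutting note 2) — exists; then Markman's engine gives C⁺.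
The ANCHORS of C⁺ are the split 14-folds `X × X̂ ≅ B × B` with the `M₂(ℚ)`-structure
`ψ_K = (0 -7; 1 0)`, `h = Θ₁ + 7Θ₂` (`W₁ = graph of √-7·φ_Θ`): their `K`-structure is typable TODAY
(`splitAnchorEndomorphism_comp_self` below, sorry-free: `ψ_K ≫ ψ_K = -7` on `B.prod B` for EVERY
abelian variety `B`), they are hyperbolic (`L ⊕ L` for a rational `E`-Lagrangian `L ⊂ H₁(B,ℚ)`;
Markman Lemma 3.1.3) and their Weil classes are Künneth components of `[Δ_B]`, hence algebraic
(Lieberman) — calibration points, as the card's ANCHOR INPUT asks.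

WHY C⁺ IS ONE STUB (typing finding, recorded for the lead; not a failure to hide): the engine /
existence split of triage M1 is NOT typable over existing declarations — (a) the tree's only REAL
semiregularity predicate `HodgeTheory.IsZeroOneSemiregular` (`σ₀, σ₁` on `Ext²` of a finite locally
free sheaf) is FALSE for every object doing Markman's job on a Weil `2n`-fold, `n ≥ 2`: for the
`n² + n` polarised non-Weil directions `ξ` one has `ob(ξ) ≠ 0` (the Weil part of `κ_n` stops being
Hodge) but `σ₀(ob ξ) = ξ⌟c₁ = 0` (trivial determinant) and `σ₁(ob ξ) = a·ξ⌟h² = 0` (`ξ` polarised,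
`B²_generic = ℚh²`); the component that detects Weil-type obstructions is `σ_{n-1} : Ext² →
H^{n+1}(Ω^{n-1})`, whose TARGET now has a carrier (`Motives.hodgeCohomology`, defn-HodgeSheavesOmega
landed) but whose MAP does not (no `At^k`, no `F ⊗ Ωᵏ`, no trace beyond `k ≤ 1`); likewise the tree's
named facts `BuchweitzFlenner2003_variationalHodge_semiregular` (`I = {1,2}`: transports `ch₁, ch₂`
only) and `Perry2026_semiregular_remainsAlgebraic` (`B₀ = 0`, `{0,1}`-semiregular) cannot move a
degree-14 class; (b) the full `σ` exists only inside the hypothesis structure `SemiregularityData`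
(junk-satisfiable under `∃`); (c) `μ_r`-twisted sheaves, Fourier–Mukai/Orlov transforms and `K`-secant
planes in the spinor module `S⁺ = H^{ev}(X,ℚ)` have no carriers. Definition requests in the line card.

The five statements S1–S5 are the spelled-out types of the registered stubs `stub_hyperbolicFourteenfolds`,
`stub_aimingArithmetic`, `stub_hyperbolicPartner` (`S2 → …`), `stub_hodgeTypeExterior`, `stub_descent`
(`S4-body → …`), `stub_hodgeModelFacts` — the ONLY sorries (lead's reshape r1: the planner's named `Prop`s were unfolded into the stub
statements so that registered signatures are self-contained text); `WeilTwelvefoldsSqrtMinus7_of` takes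
exactly those six (`Registered.stub_…` aliases = `type_of% stub_…`) as hypotheses (closed, sorry-free) and concludes the crux BY NAME;
`…_of_stubs` feeds it the stubs. Glue proved inside `_of`:
the case `c = 0`; `(A × B).dim = 14` (`dim_prod`); `(φ × φ_B)² = -7` (`prodLift_comp_self_eq_neg_nsmul`,
`ℕ`- vs `ℤ`-scalar `7`).

Disproof used (`Cruxes/WeilTwelvefoldsSqrtMinus7/Disproof.lean`, cycles 1–2, NO KILL; landed
`Theorems/WeilTwelvefoldsSqrtMinus7/Negative/{EigenvalueTyping,LadderTyping,WeilPlaneReality,KillPropagation}`):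
§2 — `IsOfHodgeType` is the one load-bearing hypothesis (`WithoutHodgeType` false on `E¹²`): honoured,
every stub keeps the per-class `(p,p)` clause (`stub_hyperbolicFourteenfolds` `(7,7)`, `stub_descent`
both ends, `stub_hodgeTypeExterior` is WHERE `(6,6) ⊗ (1,1) ↦ (7,7)` is paid for); `WithoutRationality`
≃ crux: consistent (rationality is used once, in the projector step of `stub_descent`); §1/§6 —
`λ ≠ λ̄` one Witt step up is the landed `Negative.one_add_I_sqrt7_pow_ne 14` (first `example` below),
and the split/recombine toolkit `components_mem_span_pair` / `weilComponents_conj` is what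
`stub_descent`'s proof uses with `T = (𝟙+ψ)^*`; §3 — only `p = 7`, only `(𝟙+ψ)^*` (never `ψ^*`:
`phiStar_does_not_separate`); PITFALL `pitfall_pullback_not_additive_doc` — `(𝟙 + φ×φ_B)^*` on `H¹⁴`
of the product is computed in `stub_descent` through `(𝟙+ψ) ≫ pr_A = pr_A ≫ (𝟙+φ)` and Künneth,
never as `𝟙 + φ^* + …`; §4 (arbitrary `HodgeModel` in `hhodge`) — discharged in tree
(`hodgePQ_independent_of_hodgeModel_holds`), cited in `stub_hodgeTypeExterior`; §5/§9 Targets: none;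
no stub instantiates a landed Negative lemma (they constrain witnesses, not statements); §7
`weilSixfolds_of_weilTwelvefolds`: C⁺ ⟹ crux ⟹ (with `WeilDescending`) crux 1260 as the card says.
-/

noncomputable section

set_option linter.dupNamespace false

open CategoryTheory Complex
open Literature.AlgebraicGeometry Literature.AlgebraicGeometry.Motives
  Literature.AlgebraicGeometry.HodgeTheory Literature.AlgebraicTopology.SingularHomology

namespace Summit.HodgeConjecture.HodgeConjecture.Cruxes.WeilTwelvefoldsSqrtMinus7.AmnesicSecantSheavesSplitFourteenfolds

/-! ### Disproof used: the landed typing lemmas this line answers to -/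

/-- `λ ≠ λ̄` one Witt step up (`2m = 14`): the `(𝟙+ψ)^*`-eigenvalues of the two Weil lines of a
`ℚ(√-7)`-Weil 14-fold differ — the separation behind the projector step of `stub_descent`
(landed Negative lemma `one_add_I_sqrt7_pow_ne`, cdisprove cycle 1, p72941). -/
example : (1 + I * ((Real.sqrt (7 : ℝ) : ℝ) : ℂ)) ^ 14 ≠ (1 - I * ((Real.sqrt (7 : ℝ) : ℝ) : ℂ)) ^ 14 :=
  Summit.HodgeConjecture.HodgeConjecture.Theorems.WeilTwelvefoldsSqrtMinus7.Negative.one_add_I_sqrt7_pow_ne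
    14 (by norm_num)

/-- The crux instance (`2n = 12`): the `⊔` in the crux is a direct sum (landed `weilEigenvalues_twelve_ne`). -/
example : (1 + I * ((Real.sqrt (7 : ℝ) : ℝ) : ℂ)) ^ 12 ≠ (1 - I * ((Real.sqrt (7 : ℝ) : ℝ) : ℂ)) ^ 12 :=
  Summit.HodgeConjecture.HodgeConjecture.Theorems.WeilTwelvefoldsSqrtMinus7.Negative.weilEigenvalues_twelve_ne

/-! ### The split anchors of C⁺ are typable: `ψ_K² = -7` on `B × B` for every abelian variety `B` -/

/-- **The anchor `K`-structure.** For ANY complex abelian variety `B` the endomorphism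
`ψ_K := (x, y) ↦ (-7y, x)` of `B × B` (companion matrix of `X² + 7`, i.e. `B ⊗_ℤ ℤ[√-7]`; typed with
the tree's `prodLift/fst/snd`) satisfies `ψ_K ≫ ψ_K = -7`. With `B` a principally polarised 7-fold
this is Markman's `(X × X̂, η)` up to the isogeny `𝟙 × φ_Θ` (the card: "`W₁ = graph of √-7·φ_Θ`"),
the anchor locus of C⁺; its compatible polarisation class is `pr₁^*h_B + 7·pr₂^*h_B`
(`ψ_K^*(pr₁^*h_B + m·pr₂^*h_B) = 49·pr₂^*h_B + m·pr₁^*h_B`, compatible iff `m = 7`), it is of Weil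
type `(g,g)` (`H^{1,0}(B×B) = H^{1,0}(B) ⊗ ℂ²`) and HYPERBOLIC (`L ⊕ L` is a `K`-stable `E_h`-Lagrangian
for any rational `E_{h_B}`-Lagrangian `L ⊂ H₁(B,ℚ)`; Markman Lemma 3.1.3). Sorry-free. -/
theorem splitAnchorEndomorphism_comp_self (B : AbelianVariety ℂ) :
    AbelianVariety.prodLift (AbelianVariety.snd B B ≫ (-((7 : ℤ) • 𝟙 B))) (AbelianVariety.fst B B) ≫
        AbelianVariety.prodLift (AbelianVariety.snd B B ≫ (-((7 : ℤ) • 𝟙 B))) (AbelianVariety.fst B B) =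
      -((7 : ℤ) • 𝟙 (B.prod B)) := by
  apply AbelianVariety.prod_hom_ext
  · rw [Category.assoc, AbelianVariety.prodLift_fst, ← Category.assoc, AbelianVariety.prodLift_snd]
    simp only [Preadditive.comp_neg, Preadditive.neg_comp, Preadditive.comp_zsmul,
      Preadditive.zsmul_comp, Category.comp_id, Category.id_comp]
  · rw [Category.assoc, AbelianVariety.prodLift_snd, AbelianVariety.prodLift_fst]
    simp only [Preadditive.comp_neg, Preadditive.neg_comp, Preadditive.comp_zsmul,
      Preadditive.zsmul_comp, Category.comp_id, Category.id_comp]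

/-! ### The five registered stubs (the ONLY `sorry`s of the file)

RESHAPE r1 (lead prover-line-stmt-HodgeConjecture-1261-0, 2026-08-16): the planner's five named `Prop`s
(`HyperbolicFourteenfolds`, `AimingArithmetic`, `HyperbolicPartner`, `HodgeTypeExterior`, `Descent`) are
UNFOLDED into the statements of the `stub_*` theorems themselves, so that the registered signature of each
stub is its full text over Literature / Mathlib constants only (a Theorems file cannot import this Cruxes
module, hence cannot name a `Prop` defined here; the tree's landed stubs all carry the spelled-out
statement).  The premises `AimingArithmetic →` of S3 and `HodgeTypeExterior →` of S5 are kept, spelled out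
in parentheses (token-identical to S2 / S4).  No statement changed; the composition is unchanged. -/

/-- **Stub 1 = S1 — C⁺: Hodge–Weil classes on HYPERBOLIC `ℚ(√-7)`-Weil 14-folds (hardest; the transferred
crux, Markman's Thm 1.5.1 one Witt step above the only proved case modulo ONE amnesic semiregular
`K`-secant object on an abelian 7-fold).** For a complex abelian 14-fold `X` with `ψ ≫ ψ = -7` and a
class `h ∈ H²(X(ℂ); ℂ)` which is rational, divisor-supported (`h ∈ N¹H²`), `ψ`-compatible
(`ψ^* h = 7h`, i.e. `E(√-7x, √-7y) = 7E(x,y)`), whose polarisation pairing `Q_h(x,y) = h¹³ ⌣ (x ⌣ y)`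
is non-degenerate on `H¹(X(ℂ); ℂ)`, and for which `(X, ψ, h)` is of hyperbolic Weil type (a
`ψ^*`-stable rational `Q_h`-Lagrangian `14`-frame of `H¹`; van Geemen 5.2 (2)–(3), 5.4: Witt index `7`,
`det H = (-1)⁷ = -1 ∈ ℚ^×/Nm(K^×)`): every rational `(7,7)`-class of the Weil span
`Eig((𝟙+ψ)^*, (1+i√7)¹⁴) ⊔ Eig((𝟙+ψ)^*, (1-i√7)¹⁴) ⊆ H¹⁴(X(ℂ); ℂ)` is algebraic. Off Weil type `(7,7)`
the Hodge clause makes it vacuous. INTENDED PROOF (the amnesic programme, informal until `σ_k`, `k ≥ 2`,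
twisted sheaves and Fourier–Mukai have carriers): (i) anchors `B × B` (`splitAnchorEndomorphism_comp_self`),
isogenous to Markman's `(X × X̂, η, h)`, hyperbolic, Weil classes = Künneth components of `[Δ_B]`
(algebraic, Lieberman); (ii) ONE amnesic `G`-equivariant simple theta-monad `F` on a ppav 7-fold with
`ch(F) ∈ P_α`, razor-R-admissible (first-order unobstructed along all `28 + 21` annihilator directions of
`HH²(X)`), `dim Ext²(F,F)^G = 42`, `κ₂ = a h² ≠ 0`; (iii) `ℰ = Φ(F₂ ⊠ F₁^∨)`, descent to
`Y = (X×X̂)/Ḡ`, `μ_r`-twist `ℬ` with `κ(ℰ) = q^*κ(ℬ)` (§1.5), `κ` `Spin(V)_P`-invariant (Cor. 1.3.2, all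
`n`), `κ₇` and `h⁷` spanning `ℚh⁷ ⊕ W` (Prop. 1.2.1 pattern), Markman's twisted BF theorem for abelian
families (§9) ⟹ `(Y, ℬ)` deforms over the Hodge locus of `κ(ℬ)` ⊇ the polarised Weil deformations;
(iv) CDK + Baire spreading over the irreducible component (p. 74) and completeness up to isogeny
(Landherr + Hasse: one rational hyperbolic Hermitian space of rank 14; `WeilClassesIsogenyDescent`).
Cheapest falsifier (triage, unrun): enumerate `≤ 8`-slope theta-monads solving the `P_α` moment system
and compute `dim Ext²` by the monad spectral sequence (kit; two-slope rank-(1,1) monads are RATIONAL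
secants, so the budget can only be met through differentials). [informal size XL; OPEN] -/
theorem stub_hyperbolicFourteenfolds :
    ∀ (X : AbelianVariety ℂ) (ψ : X ⟶ X), X.dim = 14 → ψ ≫ ψ = -((7 : ℤ) • 𝟙 X) →
    ∀ h : complexBetti X.X 2, IsRationalClass h → h ∈ algebraicClasses X.X 1 →
      complexBetti.map ψ.hom.hom.hom 2 h = (7 : ℂ) • h →
      (∀ x : complexBetti X.X 1,
        (∀ y : complexBetti X.X 1, polarizationPairingOne X.X h 13 x y = 0) → x = 0) →
      IsHyperbolicWeilType X ψ 7 h →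
    ∀ c : complexBetti X.X 14, IsRationalClass c → IsOfHodgeType 14 X.X 14 7 7 c →
      c ∈ Module.End.eigenspace (complexBetti.map (𝟙 X + ψ).hom.hom.hom 14).hom
            ((1 + Complex.I * (Real.sqrt (7 : ℝ) : ℂ)) ^ 14) ⊔
          Module.End.eigenspace (complexBetti.map (𝟙 X + ψ).hom.hom.hom 14).hom
            ((1 - Complex.I * (Real.sqrt (7 : ℝ) : ℂ)) ^ 14) →
      c ∈ algebraicClasses X.X 7 := by
  sorry

/-- **Stub 2 = S2 — the lever `δ² = 1`, as arithmetic of Hermitian forms over `K = ℚ(√-7)`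
(Landherr for our purpose; provable now from Meyer's theorem `meyer_holds`). Dimension-free; this is
VERBATIM the statement of stub 2 of the sibling line `WeilSixfoldsSqrtMinus7/hyperbolic-eightfold-descent`
(one proof serves both cruxes).** Let `K ∋ α`, `α² = -7`, `K = ℚ + ℚ α`; `V` a `K`-space of dimension
`2n`; `E` an alternating `ℚ`-bilinear form on `V` of Weil type (`E(α x, α y) = 7 E(x, y)`) whose
Hermitian form `H(x, y) = E(x, α y) + α E(x, y)` (van Geemen 5.2 (2); `H(x, x) = E(x, α x) ∈ ℚ`) has
SIGNATURE `(n, n)`: `V = P ⊕ N` with `H` positive definite on `P`, negative definite on `N`,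
`dim_K P = dim_K N = n`. Then for all rationals `r₁, r₂` of the same sign there are positive integers
`m₁, m₂` such that the orthogonal sum of `E` and the binary Weil form `Im⟨m₁ r₁, -m₂ r₂⟩` on `K²`
(`diagWeilForm`, Gram matrix `diag(m₁ r₁, -m₂ r₂)`, signature `(1,1)`) is HYPERBOLIC: `V × K²` contains a
`K`-subspace of dimension `n + 1` on which the summed form vanishes identically (`E|_L = 0 ⟺ H|_L = 0`
on `K`-subspaces, `Motives.forall_weilHermitianForm_eq_zero_iff`). Proof sketch: `det H = (-1)ⁿ a`,
`a > 0`; choose `m₁ = 1`, `m₂` with `a m₂ r₁ r₂ ∈ (ℚ^×)²`; an indefinite Hermitian form of rank `≥ 3`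
over `K` is isotropic because its trace form is an indefinite rational quadratic form of rank `≥ 6`
(Meyer, Serre1973 IV §3.2 Cor. 2), so by induction `H ⊕ ⟨r₁, -m₂ r₂⟩ ≅ Hypⁿ ⊕ ⟨x, -y⟩` with
`xy ∈ Nm(K^×)`, and `⟨x, -y⟩` is then a hyperbolic plane (Deligne1982HodgeCycles Cor. 4.2; van Geemen
5.4 (5.4.1)). Used here with `n = 6` (`(A, φ)` of Weil type `(6,6)`). [informal size M] -/
theorem stub_aimingArithmetic :
    ∀ (K : Type) [Field K] [Algebra ℚ K] (α : K) (hα : α * α = algebraMap ℚ K (-7))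
      (hK : ∀ k : K, ∃ a b : ℚ, k = algebraMap ℚ K a + algebraMap ℚ K b * α)
      (V : Type) [AddCommGroup V] [Module ℚ V] [Module K V] [IsScalarTower ℚ K V]
      [Module.Finite K V] (n : ℕ), Module.finrank K V = 2 * n →
    ∀ (E : LinearMap.BilinForm ℚ V), (∀ x y : V, E x y = -E y x) →
      (∀ x y : V, E (α • x) (α • y) = 7 * E x y) →
      (∃ P N : Submodule K V, Module.finrank K P = n ∧ Module.finrank K N = n ∧ P ⊓ N = ⊥ ∧
        (∀ x ∈ P, x ≠ 0 → 0 < E x (α • x)) ∧ (∀ x ∈ N, x ≠ 0 → E x (α • x) < 0)) →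
    ∀ r₁ r₂ : ℚ, 0 < r₁ * r₂ →
      ∃ m₁ m₂ : ℕ, 0 < m₁ ∧ 0 < m₂ ∧
        ∃ L : Submodule K (V × (Fin 2 → K)), Module.finrank K L = n + 1 ∧
          ∀ x ∈ L, ∀ y ∈ L,
            bilinOrthSum E
              (diagWeilForm (d := 7) (by norm_num) hα hK (Pi.basisFun K (Fin 2))
                ![(m₁ : ℚ) * r₁, -((m₂ : ℚ) * r₂)]) x y = 0 := by
  sorry

/-- **Stub 3 = S3 — the hyperbolic partner in dimension 12 (aiming lemma on the real carriers), GIVEN S2.**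
For a complex abelian 12-fold `(A, φ)`, `φ ≫ φ = -7`, which is of Weil type — witnessed, as the crux
supplies it, by a NON-ZERO rational `(6,6)`-class in its Weil span — there exist a complex abelian SURFACE
`B` with `φ_B ≫ φ_B = -7` carrying a DESCENT PAIR: eigenclasses `b₊ ∈ Eig((𝟙+φ_B)^*, (1+i√7)²)`,
`b₋ ∈ Eig((𝟙+φ_B)^*, (1-i√7)²)` in `H²(B(ℂ); ℂ)` with `b₊ + b₋` rational of type `(1,1)`, and an
algebraic class `η ∈ N¹H²(B(ℂ); ℂ)` with `b₊ ⌣ η ≠ 0`, `b₋ ⌣ η ≠ 0` in `H⁴(B(ℂ); ℂ)` (Schoen 1998 §10),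
AND a class `h ∈ H²((A × B)(ℂ); ℂ)` — rational, supported on a divisor, compatible with `ψ = φ × φ_B`
(`ψ^* h = 7 h`), with `Q_h = h¹³ ⌣ · ⌣ ·` non-degenerate on `H¹` — for which `(A × B, ψ, h)` is of
HYPERBOLIC Weil type in half-dimension `7`. Intended witness (one `B` serves every `A`; the refuters'
`E' = E` repair of `WeilDescending`, the card's `A × E × E`): `B = E × E`, `E = ℂ/ℤ[(1+√-7)/2]` (the CM
elliptic curve `y² + xy = x³ - x² - 2x - 1`, class number one), `φ_B = (ι, -ι)` with `ι = [√-7]`, so `B`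
is of Weil type `(1,1)` and `disc(B, aΘ₁ + bΘ₂) ≡ -ab`; `h = pr_A^* h_A + pr_B^*(m₁ pr₁^* h_E + m₂ pr₂^* h_E)`
with `h_A` a `K`-compatible polarisation class of `A` (exists: van Geemen 5.2 (1), averaging
`E₀ + φ^*E₀/7`) and `(m₁, m₂)` from S2 applied to `(H₁(A, ℚ), E_A)` (Weil type `(6,6)` ⟹ signature
`(6,6)`) with `r₁ = r₂ = r`, through the dictionary of `Motives/HyperbolicWeilType` (module docstring
(1)–(4): `H*(X) = ⋀*H¹`, `Q_h = c · E^* · vol`, `H|_W = 0 ⟺ E|_W = 0`, `H_{A×B} = H_A ⊕ t·H_B`,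
`t ∈ ℚ_{>0}`), so that `det H_{A×B} ≡ -disc(A)·m₁m₂ ≡ -1 = (-1)⁷`. [informal size: classically one page;
Lean XL — CM curve with `ι` as an `AbelianVariety ℂ` endomorphism, `H¹(E(ℂ))` eigen-bookkeeping, Künneth
for `H¹` of a product (`Motives/KunnethH1*`), divisor classes on carriers, a Hodge model of `B`] -/
theorem stub_hyperbolicPartner :
    (∀ (K : Type) [Field K] [Algebra ℚ K] (α : K) (hα : α * α = algebraMap ℚ K (-7))
        (hK : ∀ k : K, ∃ a b : ℚ, k = algebraMap ℚ K a + algebraMap ℚ K b * α)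
        (V : Type) [AddCommGroup V] [Module ℚ V] [Module K V] [IsScalarTower ℚ K V]
        [Module.Finite K V] (n : ℕ), Module.finrank K V = 2 * n →
      ∀ (E : LinearMap.BilinForm ℚ V), (∀ x y : V, E x y = -E y x) →
        (∀ x y : V, E (α • x) (α • y) = 7 * E x y) →
        (∃ P N : Submodule K V, Module.finrank K P = n ∧ Module.finrank K N = n ∧ P ⊓ N = ⊥ ∧
          (∀ x ∈ P, x ≠ 0 → 0 < E x (α • x)) ∧ (∀ x ∈ N, x ≠ 0 → E x (α • x) < 0)) →
      ∀ r₁ r₂ : ℚ, 0 < r₁ * r₂ →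
        ∃ m₁ m₂ : ℕ, 0 < m₁ ∧ 0 < m₂ ∧
          ∃ L : Submodule K (V × (Fin 2 → K)), Module.finrank K L = n + 1 ∧
            ∀ x ∈ L, ∀ y ∈ L,
              bilinOrthSum E
                (diagWeilForm (d := 7) (by norm_num) hα hK (Pi.basisFun K (Fin 2))
                  ![(m₁ : ℚ) * r₁, -((m₂ : ℚ) * r₂)]) x y = 0) →
    ∀ (A : AbelianVariety ℂ) (φ : A ⟶ A), A.dim = 12 → φ ≫ φ = -((7 : ℤ) • 𝟙 A) →
    (∃ c : complexBetti A.X 12, c ≠ 0 ∧ IsRationalClass c ∧ IsOfHodgeType 12 A.X 12 6 6 c ∧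
      c ∈ Module.End.eigenspace (complexBetti.map (𝟙 A + φ).hom.hom.hom 12).hom
            ((1 + Complex.I * (Real.sqrt (7 : ℝ) : ℂ)) ^ 12) ⊔
          Module.End.eigenspace (complexBetti.map (𝟙 A + φ).hom.hom.hom 12).hom
            ((1 - Complex.I * (Real.sqrt (7 : ℝ) : ℂ)) ^ 12)) →
    ∃ (B : AbelianVariety ℂ) (φB : B ⟶ B), B.dim = 2 ∧ φB ≫ φB = -((7 : ℤ) • 𝟙 B) ∧
      (∃ bp bm η : complexBetti B.X 2,
        bp ∈ Module.End.eigenspace (complexBetti.map (𝟙 B + φB).hom.hom.hom 2).hom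
              ((1 + Complex.I * (Real.sqrt (7 : ℝ) : ℂ)) ^ 2) ∧
        bm ∈ Module.End.eigenspace (complexBetti.map (𝟙 B + φB).hom.hom.hom 2).hom
              ((1 - Complex.I * (Real.sqrt (7 : ℝ) : ℂ)) ^ 2) ∧
        IsRationalClass (bp + bm) ∧ IsOfHodgeType 2 B.X 2 1 1 (bp + bm) ∧
        η ∈ algebraicClasses B.X 1 ∧
        cupProduct (show 2 + 2 = 4 from rfl) bp η ≠ 0 ∧
        cupProduct (show 2 + 2 = 4 from rfl) bm η ≠ 0) ∧
      ∃ h : complexBetti (A.prod B).X 2,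
        IsRationalClass h ∧ h ∈ algebraicClasses (A.prod B).X 1 ∧
        complexBetti.map (AbelianVariety.prodLift (AbelianVariety.fst A B ≫ φ)
            (AbelianVariety.snd A B ≫ φB)).hom.hom.hom 2 h = (7 : ℂ) • h ∧
        (∀ x : complexBetti (A.prod B).X 1,
          (∀ y : complexBetti (A.prod B).X 1,
            polarizationPairingOne (A.prod B).X h 13 x y = 0) → x = 0) ∧
        IsHyperbolicWeilType (A.prod B) (AbelianVariety.prodLift (AbelianVariety.fst A B ≫ φ)
            (AbelianVariety.snd A B ≫ φB)) 7 h := by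
  sorry

/-- **Stub 4 = S4 — Hodge types of exterior products (Künneth for Hodge models). Dimension-free; VERBATIM the
statement of stub 4 of the sibling line `WeilSixfoldsSqrtMinus7/hyperbolic-eightfold-descent` (one proof
serves both cruxes and `WeilDescending`, item 1263).** For complex abelian varieties `A`, `B` of
dimensions `a`, `b` and classes `c ∈ Hᵏ(A(ℂ); ℂ)` of type `(p, q)`, `w ∈ Hˡ(B(ℂ); ℂ)` of type
`(p', q')` (in the tree's sense `IsOfHodgeType`: for SOME Hodge model — harmless by the landed
`hodgePQ_independent_of_hodgeModel_holds`, Disproof §4), the exterior product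
`pr_A^* c ⌣ pr_B^* w ∈ H^{k+l}((A × B)(ℂ); ℂ)` is of type `(p + p', q + q')` for the dimension parameter
`a + b` (Voisin I §11.3.2 / Thm 11.38: the Künneth isomorphism is an isomorphism of Hodge structures and
the cup product a morphism of Hodge structures; on Hodge models: the product manifold with the product
Kähler metric, wedge of harmonic = translation-invariant forms on tori). Turns the layer's hypothesis
predicates `PreservesHodgeType` (for `pr_A^*`, `pr_B^*`) and `CupPreservesHodgeType` into a theorem for
products of abelian varieties; it is where this line pays for `(6,6) ⊗ (1,1) ↦ (7,7)` (Disproof §2: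
the Hodge clause is the load-bearing hypothesis). [informal size L] -/
theorem stub_hodgeTypeExterior :
    (∀ (m : ℕ) (Y : SchemeOver ℂ), nonempty_hodgeModel m Y) →
    (∀ (E : Type) [NormedAddCommGroup E] [NormedSpace ℂ E] [FiniteDimensional ℂ E],
      Literature.NumberTheory.Transcendental.exists_deRhamIsoFamily (modelWithCornersSelf ℝ E)) →
    ∀ (A B : AbelianVariety ℂ) (a b : ℕ), A.dim = a → B.dim = b →
    ∀ (k l m : ℕ) (hklm : k + l = m) (p q p' q' : ℕ)
      (c : complexBetti A.X k) (w : complexBetti B.X l),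
      IsOfHodgeType a A.X k p q c → IsOfHodgeType b B.X l p' q' w →
      IsOfHodgeType (a + b) (A.prod B).X m (p + p') (q + q')
        (cupProduct hklm (complexBetti.map (AbelianVariety.fst A B).hom.hom.hom k c)
          (complexBetti.map (AbelianVariety.snd A B).hom.hom.hom l w)) := by
  sorry

/-- **Stub 5 = S5 — Schoen's descent `14 → 12` for ONE partner surface, GIVEN S4** (the card's
`HypSplitFourteenSuffices` cut at the surface `B = E × E`). Let `(A, φ)` be a complex abelian 12-fold
and `(B, φ_B)` a complex abelian surface, `φ² = φ_B² = -7`, `B` carrying a descent pair `(b₊, b₋, η)`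
as in S3, and `ψ = φ × φ_B` on `A × B`. IF every rational `(7,7)`-class in the Weil span
`Eig((𝟙+ψ)^*, (1+i√7)¹⁴) ⊔ Eig((𝟙+ψ)^*, (1-i√7)¹⁴)` of `A × B` is algebraic, THEN every rational
`(6,6)`-class `c = c₊ + c₋` in the Weil span of `A` is algebraic. Proof (Schoen1998HodgeWeilAddendum
§10; Markman2025SurveySecant §11.5 Step 2; Koike's trick; the tree's `WeilClassesProducts` /
`WeilClassesFourfoldsProofs` patterns `4 ← 6` one rung up): `P = pr_A^* c ⌣ pr_B^*(b₊ + b₋)` is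
rational (`isRationalClass_cupProduct_map_fst_map_snd`) and `(7,7)` (S4); with `T = (𝟙 + ψ)^*`
(`(𝟙+ψ) ≫ pr_A = pr_A ≫ (𝟙+φ)` — the PITFALL of Disproof `pitfall_pullback_not_additive_doc` is
avoided: `T` is computed factorwise through Künneth, never as `𝟙 + φ^* + …`) its four pieces have
eigenvalues `λ₊¹⁴, λ₋¹⁴, λ₊¹²λ₋², λ₋¹²λ₊²` (`λ± = 1 ± i√7`; pairwise distinct since `λ₊/λ₋` is no root
of unity — `Negative.mixed_eq_plus_iff`), so `Q = q(T)P`, `TQ` (`q(X) = (X - λ₊¹²λ₋²)(X - λ₋¹²λ₊²) ∈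
ℤ[X]`: `β + β̄ = 2·8²·Re λ₊¹⁰`, `ββ̄ = 8¹⁴`) are rational `(7,7)` Weil classes of `A × B`, hence
algebraic, hence so are `P₊₊ = pr_A^*c₊ ⌣ pr_B^*b₊` and `P₋₋` (`mem_and_mem_of_smul_add_smul_mem`,
the 2×2 inversion `Negative.components_mem_span_pair`); `P±± ⌣ pr_B^* η ∈ N⁸H¹⁶` (cup with the flat
pull-back of a divisor class after moving the divisor by a translation of `B` — translations act
trivially on `H*(B(ℂ))`); and `pr_{A*}(P±± ⌣ pr_B^* η) = c± ⌣ pr_{A*}pr_B^*(b± ⌣ η) = ε± · c±` with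
`ε± ≠ 0` because `b± ⌣ η ≠ 0` spans `H⁴(B(ℂ); ℂ) ≅ ℂ` (real Gysin `complexGysin` + Poincaré duality,
projection formula `complexGysin_cup`, Gysin maps preserve `N^•`:
`gysinMap_mem_supportedClasses_of_isSmoothProjective`), so `c±`, hence `c`, are algebraic.
[informal size L] -/
theorem stub_descent :
    (∀ (A B : AbelianVariety ℂ) (a b : ℕ), A.dim = a → B.dim = b →
      ∀ (k l m : ℕ) (hklm : k + l = m) (p q p' q' : ℕ)
        (c : complexBetti A.X k) (w : complexBetti B.X l),
        IsOfHodgeType a A.X k p q c → IsOfHodgeType b B.X l p' q' w →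
        IsOfHodgeType (a + b) (A.prod B).X m (p + p') (q + q')
          (cupProduct hklm (complexBetti.map (AbelianVariety.fst A B).hom.hom.hom k c)
            (complexBetti.map (AbelianVariety.snd A B).hom.hom.hom l w))) →
    ∀ (A : AbelianVariety ℂ) (φ : A ⟶ A) (B : AbelianVariety ℂ) (φB : B ⟶ B),
      A.dim = 12 → B.dim = 2 → φ ≫ φ = -((7 : ℤ) • 𝟙 A) → φB ≫ φB = -((7 : ℤ) • 𝟙 B) →
      (∃ bp bm η : complexBetti B.X 2,
        bp ∈ Module.End.eigenspace (complexBetti.map (𝟙 B + φB).hom.hom.hom 2).hom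
              ((1 + Complex.I * (Real.sqrt (7 : ℝ) : ℂ)) ^ 2) ∧
        bm ∈ Module.End.eigenspace (complexBetti.map (𝟙 B + φB).hom.hom.hom 2).hom
              ((1 - Complex.I * (Real.sqrt (7 : ℝ) : ℂ)) ^ 2) ∧
        IsRationalClass (bp + bm) ∧ IsOfHodgeType 2 B.X 2 1 1 (bp + bm) ∧
        η ∈ algebraicClasses B.X 1 ∧
        cupProduct (show 2 + 2 = 4 from rfl) bp η ≠ 0 ∧
        cupProduct (show 2 + 2 = 4 from rfl) bm η ≠ 0) →
      (∀ u : complexBetti (A.prod B).X 14, IsRationalClass u →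
        IsOfHodgeType 14 (A.prod B).X 14 7 7 u →
        u ∈ Module.End.eigenspace (complexBetti.map (𝟙 (A.prod B) +
                AbelianVariety.prodLift (AbelianVariety.fst A B ≫ φ)
                  (AbelianVariety.snd A B ≫ φB)).hom.hom.hom 14).hom
              ((1 + Complex.I * (Real.sqrt (7 : ℝ) : ℂ)) ^ 14) ⊔
            Module.End.eigenspace (complexBetti.map (𝟙 (A.prod B) +
                AbelianVariety.prodLift (AbelianVariety.fst A B ≫ φ)
                  (AbelianVariety.snd A B ≫ φB)).hom.hom.hom 14).hom
              ((1 - Complex.I * (Real.sqrt (7 : ℝ) : ℂ)) ^ 14) →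
        u ∈ algebraicClasses (A.prod B).X 7) →
      ∀ c : complexBetti A.X 12, IsRationalClass c → IsOfHodgeType 12 A.X 12 6 6 c →
        c ∈ Module.End.eigenspace (complexBetti.map (𝟙 A + φ).hom.hom.hom 12).hom
              ((1 + Complex.I * (Real.sqrt (7 : ℝ) : ℂ)) ^ 12) ⊔
            Module.End.eigenspace (complexBetti.map (𝟙 A + φ).hom.hom.hom 12).hom
              ((1 - Complex.I * (Real.sqrt (7 : ℝ) : ℂ)) ^ 12) →
        c ∈ algebraicClasses A.X 6 := by
  sorry

/-- **Stub 6 — the two Literature NAMED FACTS Stub 4 consumes (lead's reshape r1; the only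
non-geometric obligation of the line, registered so that the composition stays closed and the
dependency is tracked, not hidden).** (a) `nonempty_hodgeModel m Y` for every `m`, `Y`
(`HodgeTheory/HodgeModelExistence`: a smooth projective complex variety has a Hodge model —
analytification (Serre, GAGA §2) + a natural de Rham comparison (de Rham) + the Hodge decomposition
(`X^an` compact Kähler, Voisin I Thm. 6.18); vacuous off smooth projective `Y`); (b) de Rham's theorem
in multiplicative form `exists_deRhamIsoFamily 𝓘(ℝ, E)` for every finite-dimensional complex model
space (`NumberTheory/Transcendental/DeRhamTheorem`: Warner Thm. 5.36/5.45; the natural integration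
family `integrationDeRhamIsoFamily` is in tree, multiplicativity is the open part).  With (a), (b) and
the PROVED `hodgePQ_independent_of_hodgeModel_holds`, pull-backs and cup products preserve Hodge types
(`preservesHodgeType_of_nonempty_hodgeModel`, `cupPreservesHodgeType_of_nonempty_hodgeModel`), which is
all Stub 4 needs.  A worker either discharges them (`…_holds`) or replies `stub-blocked` naming them.
[cite: SerreGAGA1956, §2] [cite: WarnerGTM94, Thm. 5.36 / Thm. 5.45] [informal size: (a) XL, (b) L] -/
theorem stub_hodgeModelFacts :
    (∀ (m : ℕ) (Y : SchemeOver ℂ), nonempty_hodgeModel m Y) ∧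
    (∀ (E : Type) [NormedAddCommGroup E] [NormedSpace ℂ E] [FiniteDimensional ℂ E],
      Literature.NumberTheory.Transcendental.exists_deRhamIsoFamily (modelWithCornersSelf ℝ E)) := by
  sorry

/-! ### Name-keyed aliases of the six stub statements (the hypotheses of the composition; the tree's
skeleton convention: the audit admits a hypothesis of `_of` iff its head constant is named like a
registered stub — `type_of%` keeps ONE source of truth for each statement) -/
namespace Registered

/-- Alias of the statement of `stub_hyperbolicFourteenfolds` (S1, C⁺). -/
abbrev stub_hyperbolicFourteenfolds : Prop := type_of% AmnesicSecantSheavesSplitFourteenfolds.stub_hyperbolicFourteenfolds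
/-- Alias of the statement of `stub_aimingArithmetic` (S2). -/
abbrev stub_aimingArithmetic : Prop := type_of% AmnesicSecantSheavesSplitFourteenfolds.stub_aimingArithmetic
/-- Alias of the statement of `stub_hyperbolicPartner` (S3). -/
abbrev stub_hyperbolicPartner : Prop := type_of% AmnesicSecantSheavesSplitFourteenfolds.stub_hyperbolicPartner
/-- Alias of the statement of `stub_hodgeTypeExterior` (S4). -/
abbrev stub_hodgeTypeExterior : Prop := type_of% AmnesicSecantSheavesSplitFourteenfolds.stub_hodgeTypeExterior
/-- Alias of the statement of `stub_descent` (S5). -/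
abbrev stub_descent : Prop := type_of% AmnesicSecantSheavesSplitFourteenfolds.stub_descent
/-- Alias of the statement of `stub_hodgeModelFacts` (S6). -/
abbrev stub_hodgeModelFacts : Prop := type_of% AmnesicSecantSheavesSplitFourteenfolds.stub_hodgeModelFacts

end Registered

/-! ### The composition (concludes the crux BY NAME; sorry-free glue) -/

/-- **`WeilTwelvefoldsSqrtMinus7` from the six stubs** (S1–S5 + the named-facts stub S6 feeding S4). Given a 12-fold `(A, φ)` and a rational
`(6,6)` Weil class `c`: if `c = 0` it is algebraic; otherwise `c` witnesses Weil type, S3 (fed S2)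
yields the partner surface `B`, its descent pair and a hyperbolic compatible divisor class `h` on
`A × B`; `A × B` has dimension `14` (`dim_prod`) and `(φ × φ_B)² = -7`
(`prodLift_comp_self_eq_neg_nsmul`), so S1 (C⁺) makes the rational `(7,7)` Weil classes of
`(A × B, φ × φ_B)` algebraic, and S5 (fed S4) descends to `c`. -/
theorem WeilTwelvefoldsSqrtMinus7_of
    (h₁ : Registered.stub_hyperbolicFourteenfolds) (h₂ : Registered.stub_aimingArithmetic)
    (h₃ : Registered.stub_hyperbolicPartner) (h₄ : Registered.stub_hodgeTypeExterior)
    (h₅ : Registered.stub_descent) (h₆ : Registered.stub_hodgeModelFacts) :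
    Summit.HodgeConjecture.HodgeConjecture.Theses.HeckePrymWeil.WeilTwelvefoldsSqrtMinus7 := by
  intro A φ hA hφ c hrat hH hW
  by_cases hc : c = 0
  · rw [hc]
    exact Submodule.zero_mem _
  obtain ⟨B, φB, hB, hφB, hpair, h, hhr, hha, hhc, hhn, hhyp⟩ :=
    h₃ h₂ A φ hA hφ ⟨c, hc, hrat, hH, hW⟩
  have hdim : (A.prod B).dim = 14 := by rw [AbelianVariety.dim_prod, hA, hB]
  have hφ' : φ ≫ φ = -((7 : ℕ) • 𝟙 A) := by rw [hφ, ← natCast_zsmul]; rfl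
  have hφB' : φB ≫ φB = -((7 : ℕ) • 𝟙 B) := by rw [hφB, ← natCast_zsmul]; rfl
  have hsq : AbelianVariety.prodLift (AbelianVariety.fst A B ≫ φ) (AbelianVariety.snd A B ≫ φB) ≫
      AbelianVariety.prodLift (AbelianVariety.fst A B ≫ φ) (AbelianVariety.snd A B ≫ φB) =
        -((7 : ℤ) • 𝟙 (A.prod B)) := by
    rw [prodLift_comp_self_eq_neg_nsmul hφ' hφB', ← natCast_zsmul]; rfl
  exact h₅ (h₄ h₆.1 h₆.2) A φ B φB hA hB hφ hφB hpair
    (h₁ (A.prod B) _ hdim hsq h hhr hha hhc hhn hhyp) c hrat hH hW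

/-- The crux from the stubs as they stand (depends on their `sorry`s; shows the wiring closes). -/
theorem WeilTwelvefoldsSqrtMinus7_of_stubs :
    Summit.HodgeConjecture.HodgeConjecture.Theses.HeckePrymWeil.WeilTwelvefoldsSqrtMinus7 :=
  WeilTwelvefoldsSqrtMinus7_of stub_hyperbolicFourteenfolds stub_aimingArithmetic
    stub_hyperbolicPartner stub_hodgeTypeExterior stub_descent stub_hodgeModelFacts

end Summit.HodgeConjecture.HodgeConjecture.Cruxes.WeilTwelvefoldsSqrtMinus7.AmnesicSecantSheavesSplitFourteenfolds

end
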